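import Summits.CriticalPhenomena.PercolationContinuityZ3.Theorems.Transplant.AutChartOrbitsQDatum
import HarnessLib

/-!
# The orbit datum with QUASI-STEPS, II (customer side of the path-step rung (N3-b)): (κ″) the cylinders at every representative are connected INSIDE A
# FATTENING BY `N` from some width on, and THE DATUM EXISTS for every action with finitely many orbits and a rank-two character killing a stabiliser, off
# exponential growth — NO step hypothesis

builds on p205010 (kernel theorem, internal audit signed; external expert review pending) — nothing in this file uses p205010 and nothing here is a percolation
statement or a claim about any node.  Lane `prim-bschramm`, seat `prim-bschramm-p3` gen 28 (design owner; N3B-RUNG.md §3 (κ″) / §6).  Helper file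
(`--supports stmt-CriticalPhenomena-4575 --as helper`).  Sequel of «AutChartOrbitsQDatum».

* §1 radii and the box floor `ℓ₀ := N·D_reps + N·R₁ + N + N·m` (as in «AutChartOrbitsCylinders»; a reduced vertex is joined to every representative inside the box
  of radius `ℓ₀` — kernel walk + representative walk, no steps involved);
* §2 **`reduce_coord`** UNDER QUASI-STEPS: from a vertex of the cylinder `‖φ‖_∞ ≤ ℓ` (`ℓ ≥ N`) the realising walks of the quasi-steps lead to a vertex with the
  `i`-th coordinate in `[0, N)` and the other coordinate unchanged, INSIDE THE FATTENED CYLINDER `‖φ‖_∞ ≤ ℓ + N` (each move starts in the cylinder and wiggles by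
  `≤ N`); hence **`cyl_reach_of_le`**: for `ℓ ≥ ℓ₀` any two vertices of `cyl r ℓ` are joined inside `cyl r (ℓ + N)` — the form (κ″) of N3B-RUNG §3 (induced
  connectivity of `cyl r ℓ` itself can fail under quasi-steps);
* §3 **`exists_orbitQDatum`**: finitely many orbits (transversal), a character killing ONE stabiliser, RANK TWO, no exponential growth ⟹ `Nonempty (OrbitQDatum G A)`
  — good coordinates («AutChartOrbitsGoodCoordinates» p494591) for `N`, the bound and the quasi-steps, the relative Milnor kernel lemma for `m` (as in
  `exists_orbitDatum`).  Together with «AutChartOrbitsQDatum» (`chart_lip`, `qstep_at`, frames by `sec`, `chart_of_mem`) this is the complete customer-side input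
  of a quasi-step From carrier for EVERY such action: what remains for «every Cayley graph of every group virtually onto ℤ², every finite generating set» is the
  node (the planners' rung), not the customer.
[cite: KozmaNitzan2024, §4 pp. 15–16 (boxes; Lemma 8)] [cite: MartineauTassion2017, §3.2] [cite: BenjaminiSchramm1996, §2 (almost transitive graphs)]
[cite: MilnorSolvableGrowth1968, Lemma 1]
-/

noncomputable section

namespace Summit.CriticalPhenomena.PercolationContinuityZ3.Theorems.Transplant

open SimpleGraph Filter Literature.Barriers.CriticalPhenomena Literature.Probability.LatticeModels Literature.Probability.Percolation
open scoped Classical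

namespace AutChart

variable {V : Type} {G : SimpleGraph V} {A : Type} [Group A] [MulAction A V]

namespace OrbitQDatum

/-! ## §1 Radii and the box floor -/

/-- Every vertex is at finite distance from every vertex. [folklore] -/
theorem exists_rad (D : OrbitQDatum G A) (u v : V) : ∃ n : ℕ, v ∈ graphBall G u n := by
  obtain ⟨w⟩ := D.conn.preconnected u v
  exact ⟨w.length, w, le_rfl⟩

/-- A radius at which `v` is seen from `u`. [folklore] -/
def rad (D : OrbitQDatum G A) (u v : V) : ℕ := Classical.choose (D.exists_rad u v)

/-- `v ∈ B(u, rad u v)`. [folklore] -/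
theorem mem_graphBall_rad (D : OrbitQDatum G A) (u v : V) : v ∈ graphBall G u (D.rad u v) := Classical.choose_spec (D.exists_rad u v)

/-- **A bound for the distances between representatives.** [folklore] -/
def Drep (D : OrbitQDatum G A) : ℕ := D.reps.sup fun r => D.reps.sup fun r' => D.rad r r'

/-- `rad r r' ≤ Drep` on the transversal. [folklore] -/
theorem rad_le_Drep (D : OrbitQDatum G A) {r r' : V} (hr : r ∈ D.reps) (hr' : r' ∈ D.reps) : D.rad r r' ≤ D.Drep :=
  le_trans (Finset.le_sup (f := fun r'' => D.rad r r'') hr') (Finset.le_sup (f := fun r => D.reps.sup fun r'' => D.rad r r'') hr)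

/-- **The representatives' radius**: every reduced chart value occurring in a type has a representative vertex of that type in `B(type, R₁)`. [folklore] -/
def R1 (D : OrbitQDatum G A) : ℕ := D.reps.sup fun r' => ((Finset.range D.N) ×ˢ (Finset.range D.N)).sup fun ab =>
  if h : ∃ v : V, D.typ v = r' ∧ D.chart v = CayleyScaled.vec ab.1 ab.2 then D.rad r' (Classical.choose h) else 0

/-- **The width floor `ℓ₀ = N D_reps + N R₁ + N + N m`.** [folklore] -/
def ℓ₀ (D : OrbitQDatum G A) : ℕ := D.N * D.Drep + D.N * D.R1 + D.N + D.N * D.m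

/-- **A reduced vertex (`φ ∈ [0, N)²`) is joined to EVERY representative inside the box of radius `ℓ₀`**: go to the vertex's type, take a kernel walk to
`k • type`, then the `k`-translate of a walk to the representative vertex of its chart value. [folklore] -/
theorem inBox_of_reduced (D : OrbitQDatum G A) {r : V} (hr : r ∈ D.reps) {v : V} (hv : ∀ i : Fin 2, 0 ≤ D.chart v i ∧ D.chart v i < D.N) :
    D.InBox D.ℓ₀ r v := by
  set r' : V := D.typ v with hr'_def
  have hr' : r' ∈ D.reps := D.typ_mem v
  set a : ℕ := (D.chart v 0).toNat with ha
  set b : ℕ := (D.chart v 1).toNat with hb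
  have h0 := hv 0
  have h1 := hv 1
  have hφv : D.chart v = CayleyScaled.vec a b := by
    funext i; fin_cases i
    · show D.chart v 0 = ((D.chart v 0).toNat : ℤ); rw [Int.toNat_of_nonneg h0.1]
    · show D.chart v 1 = ((D.chart v 1).toNat : ℤ); rw [Int.toNat_of_nonneg h1.1]
  have hex : ∃ v' : V, D.typ v' = r' ∧ D.chart v' = CayleyScaled.vec a b := ⟨v, rfl, hφv⟩
  set ρ : V := Classical.choose hex with hρ
  have hρ' : D.typ ρ = r' ∧ D.chart ρ = CayleyScaled.vec a b := Classical.choose_spec hex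
  have hab : (a, b) ∈ (Finset.range D.N) ×ˢ (Finset.range D.N) := by
    rw [Finset.mem_product, Finset.mem_range, Finset.mem_range]
    constructor
    · have : (a : ℤ) < D.N := by rw [ha, Int.toNat_of_nonneg h0.1]; exact h0.2
      exact_mod_cast this
    · have : (b : ℤ) < D.N := by rw [hb, Int.toNat_of_nonneg h1.1]; exact h1.2
      exact_mod_cast this
  have hrad : D.rad r' ρ ≤ D.R1 := by
    have h := Finset.le_sup (f := fun ab : ℕ × ℕ => if h : ∃ v' : V, D.typ v' = r' ∧ D.chart v' = CayleyScaled.vec ab.1 ab.2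
      then D.rad r' (Classical.choose h) else 0) hab
    simp only [dif_pos hex] at h
    exact le_trans h (Finset.le_sup (f := fun r'' => ((Finset.range D.N) ×ˢ (Finset.range D.N)).sup fun ab =>
      if h : ∃ v' : V, D.typ v' = r'' ∧ D.chart v' = CayleyScaled.vec ab.1 ab.2 then D.rad r'' (Classical.choose h) else 0) hr')
  -- the kernel element carrying `ρ` to `v`
  set k : A := D.sec v * (D.sec ρ)⁻¹ with hk_def
  have hk : D.ψ k = 0 := by
    rw [hk_def, D.ψ_mul, D.ψ_inv, ← D.chart_eq, ← D.chart_eq, hφv, hρ'.2, add_neg_cancel]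
  have hρr : (D.sec ρ)⁻¹ • ρ = r' := by rw [inv_smul_eq_iff, ← hρ'.1, D.sec_smul]
  have hkr : k • ρ = v := by rw [hk_def, mul_smul, hρr, hr'_def, D.sec_smul]
  have hA : D.InBox (D.N * D.Drep) r r' :=
    D.inBox_mono (Nat.mul_le_mul_left _ (D.rad_le_Drep hr hr')) (D.inBox_of_mem_graphBall hr (D.mem_graphBall_rad r r'))
  have hB : D.InBox (D.N * D.m) r' (k • r') := D.ker_inBox hr' hk
  have hC : D.InBox (D.N * D.R1) r' ρ := D.inBox_mono (Nat.mul_le_mul_left _ hrad) (D.inBox_of_mem_graphBall hr' (D.mem_graphBall_rad r' ρ))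
  have hC' := D.inBox_smul k (S := 0) (fun i => by rw [hk, Pi.zero_apply, abs_zero]; rfl) hC
  rw [Nat.zero_add, hkr] at hC'
  exact D.inBox_trans (D.inBox_mono (by unfold ℓ₀; omega) hA)
    (D.inBox_trans (D.inBox_mono (by unfold ℓ₀; omega) hB) (D.inBox_mono (by unfold ℓ₀; omega) hC'))

/-- The deviation of a chart coordinate from the block `[0, N)` (a termination measure for the reduction). [folklore] -/
def excess (D : OrbitQDatum G A) (x : ℤ) : ℕ := (-x).toNat + (x - D.N + 1).toNat

/-! ## §2 Coordinate reduction under quasi-steps, inside the fattened cylinder -/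

/-- A vertex whose chart is within sup-distance `N` of a vertex of the cylinder `‖φ‖_∞ ≤ ℓ` lies in the cylinder of width `ℓ + N`. [folklore] -/
theorem mem_cylFat (D : OrbitQDatum G A) {r : V} (hr : r ∈ D.reps) {ℓ : ℕ} {v x : V} (hv : v ∈ {w | D.chart w - D.chart r ∈ box 2 ℓ})
    (hx : ∀ j : Fin 2, |D.chart x j - D.chart v j| ≤ D.N) : x ∈ {w | D.chart w - D.chart r ∈ box 2 (ℓ + D.N)} := by
  have hvb : D.chart v ∈ box 2 ℓ := by have := hv; simp only [Set.mem_setOf_eq, D.chart_of_mem hr, sub_zero] at this; exact this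
  show D.chart x - D.chart r ∈ box 2 (ℓ + D.N)
  rw [D.chart_of_mem hr, sub_zero, mem_box]
  rw [mem_box] at hvb
  intro j
  have h1 := hvb j
  have h2 := hx j
  rw [abs_le] at h2
  push_cast
  constructor <;> omega

/-- The cylinder lies in its fattening. [folklore] -/
theorem mem_cylFat_self (D : OrbitQDatum G A) {r : V} (hr : r ∈ D.reps) {ℓ : ℕ} {v : V} (hv : v ∈ {w | D.chart w - D.chart r ∈ box 2 ℓ}) :
    v ∈ {w | D.chart w - D.chart r ∈ box 2 (ℓ + D.N)} :=
  D.mem_cylFat hr hv fun j => by rw [sub_self, abs_zero]; exact Int.natCast_nonneg _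

/-- **One quasi-step move inside the fattened cylinder**: from `v` in the cylinder of width `ℓ`, a vertex `v₁` with `φ v₁ = φ v + N σ eᵢ`, joined to `v` inside the
cylinder of width `ℓ + N`. [this work] -/
theorem exists_move (D : OrbitQDatum G A) {r : V} (hr : r ∈ D.reps) {ℓ : ℕ} (v : V) (hvm : v ∈ {w | D.chart w - D.chart r ∈ box 2 ℓ}) (i : Fin 2) (σ : ℤˣ) :
    ∃ (v₁ : V), D.chart v₁ = D.chart v + Pi.single i ((D.N : ℤ) * σ) ∧ ∃ (h₁ : v₁ ∈ {w | D.chart w - D.chart r ∈ box 2 (ℓ + D.N)}),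
      (G.induce {w | D.chart w - D.chart r ∈ box 2 (ℓ + D.N)}).Reachable ⟨v, D.mem_cylFat_self hr hvm⟩ ⟨v₁, h₁⟩ := by
  obtain ⟨v₁, p, -, hφ, htr⟩ := D.qstep_at v i σ
  have hsupp : ∀ x ∈ p.support, x ∈ {w | D.chart w - D.chart r ∈ box 2 (ℓ + D.N)} := fun x hx => D.mem_cylFat hr hvm (htr x hx)
  exact ⟨v₁, hφ, hsupp _ (Walk.end_mem_support p), ⟨p.induce _ hsupp⟩⟩

/-- **Reduction of ONE coordinate under quasi-steps**: from any vertex of the cylinder `‖φ‖_∞ ≤ ℓ` (`ℓ ≥ N`) the quasi-step walks lead, INSIDE the cylinder of width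
`ℓ + N`, to a vertex of the cylinder of width `ℓ` whose `i`-th coordinate lies in `[0, N)` and whose other coordinate is unchanged. [this work] -/
theorem reduce_coord (D : OrbitQDatum G A) {r : V} (hr : r ∈ D.reps) (i : Fin 2) {ℓ : ℕ} (hℓ : D.N ≤ ℓ) :
    ∀ (n : ℕ) (v : V) (hvm : v ∈ {w | D.chart w - D.chart r ∈ box 2 ℓ}), D.excess (D.chart v i) ≤ n →
      ∃ (v' : V) (hv'm : v' ∈ {w | D.chart w - D.chart r ∈ box 2 ℓ}),
        (0 ≤ D.chart v' i ∧ D.chart v' i < D.N) ∧ (∀ j, j ≠ i → D.chart v' j = D.chart v j) ∧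
        (G.induce {w | D.chart w - D.chart r ∈ box 2 (ℓ + D.N)}).Reachable ⟨v, D.mem_cylFat_self hr hvm⟩ ⟨v', D.mem_cylFat_self hr hv'm⟩ := by
  intro n
  induction n with
  | zero =>
    intro v hvm hex
    refine ⟨v, hvm, ?_, fun j _ => rfl, Reachable.refl _⟩
    unfold excess at hex
    constructor <;> omega
  | succ n ih =>
    intro v hvm hex
    by_cases hin : 0 ≤ D.chart v i ∧ D.chart v i < D.N
    · exact ⟨v, hvm, hin, fun j _ => rfl, Reachable.refl _⟩
    · have hvbox : D.chart v ∈ box 2 ℓ := by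
        have := hvm; simp only [Set.mem_setOf_eq, D.chart_of_mem hr, sub_zero] at this; exact this
      rw [mem_box] at hvbox
      -- the sign of the move: up if the coordinate is negative, down if it is `≥ N`
      have hσ : ∃ σ : ℤˣ, (D.chart v i < 0 ∧ (σ : ℤ) = 1) ∨ ((D.N : ℤ) ≤ D.chart v i ∧ (σ : ℤ) = -1) := by
        by_cases hneg : D.chart v i < 0
        · exact ⟨1, Or.inl ⟨hneg, rfl⟩⟩
        · refine ⟨-1, Or.inr ⟨?_, by simp⟩⟩
          push Not at hneg
          by_contra hlt; push Not at hlt; exact hin ⟨hneg, hlt⟩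
      obtain ⟨σ, hσ⟩ := hσ
      obtain ⟨v₁, hφ₁, hv₁f, hreach₁⟩ := D.exists_move hr v hvm i σ
      have hφ₁i : D.chart v₁ i = D.chart v i + D.N * (σ : ℤ) := by rw [hφ₁, Pi.add_apply, Pi.single_eq_same]
      have hφ₁j : ∀ j, j ≠ i → D.chart v₁ j = D.chart v j := fun j hj => by
        rw [hφ₁, Pi.add_apply, Pi.single_eq_of_ne hj, add_zero]
      have hN1 := D.one_le_N
      have hv₁m : v₁ ∈ {w | D.chart w - D.chart r ∈ box 2 ℓ} := by
        show D.chart v₁ - D.chart r ∈ box 2 ℓ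
        rw [D.chart_of_mem hr, sub_zero, mem_box]
        intro j
        by_cases hj : j = i
        · subst hj; rw [hφ₁i]; have := hvbox j
          rcases hσ with ⟨h1, h2⟩ | ⟨h1, h2⟩ <;> rw [h2] <;> constructor <;> nlinarith
        · rw [hφ₁j j hj]; exact hvbox j
      have hex₁ : D.excess (D.chart v₁ i) ≤ n := by
        rw [hφ₁i]; unfold excess at hex ⊢
        rcases hσ with ⟨h1, h2⟩ | ⟨h1, h2⟩ <;> rw [h2] <;> omega
      obtain ⟨v', hv'm, hv'in, hv'j, hreach⟩ := ih v₁ hv₁m hex₁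
      refine ⟨v', hv'm, hv'in, fun j hj => by rw [hv'j j hj, hφ₁j j hj], ?_⟩
      have e : (⟨v₁, hv₁f⟩ : {w | D.chart w - D.chart r ∈ box 2 (ℓ + D.N)}) = ⟨v₁, D.mem_cylFat_self hr hv₁m⟩ := rfl
      exact hreach₁.trans (e ▸ hreach)

/-- **(κ″) THE CYLINDERS AT EVERY REPRESENTATIVE ARE CONNECTED INSIDE THEIR `N`-FATTENING, from `ℓ₀` on**: any two vertices of `{‖φ‖_∞ ≤ ℓ}` (`ℓ ≥ ℓ₀`) are joined by
a walk inside `{‖φ‖_∞ ≤ ℓ + N}` (reduce both coordinates by quasi-steps inside the fattening, then join the reduced vertex to `r` inside the box of radius `ℓ₀`).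
[cite: KozmaNitzan2024, §4 p. 15 (boxes)] -/
theorem cyl_reach_of_le (D : OrbitQDatum G A) {r : V} (hr : r ∈ D.reps) {ℓ : ℕ} (hℓ : D.ℓ₀ ≤ ℓ) {u v : V}
    (hu : u ∈ {w | D.chart w - D.chart r ∈ box 2 ℓ}) (hv : v ∈ {w | D.chart w - D.chart r ∈ box 2 ℓ}) :
    (G.induce {w | D.chart w - D.chart r ∈ box 2 (ℓ + D.N)}).Reachable ⟨u, D.mem_cylFat_self hr hu⟩ ⟨v, D.mem_cylFat_self hr hv⟩ := by
  have hNℓ : D.N ≤ ℓ := le_trans (by unfold ℓ₀; omega) hℓ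
  have ht : r ∈ {w | D.chart w - D.chart r ∈ box 2 ℓ} := by
    show D.chart r - D.chart r ∈ box 2 ℓ; rw [sub_self]; exact zero_mem_box 2 ℓ
  have key : ∀ (x : V) (hx : x ∈ {w | D.chart w - D.chart r ∈ box 2 ℓ}),
      (G.induce {w | D.chart w - D.chart r ∈ box 2 (ℓ + D.N)}).Reachable ⟨r, D.mem_cylFat_self hr ht⟩ ⟨x, D.mem_cylFat_self hr hx⟩ := by
    intro x hxm
    obtain ⟨x₁, hx₁m, hx₁in, _, hr₁⟩ := D.reduce_coord hr 0 hNℓ _ x hxm le_rfl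
    obtain ⟨x₂, hx₂m, hx₂in, hx₂j, hr₂⟩ := D.reduce_coord hr 1 hNℓ _ x₁ hx₁m le_rfl
    have hred : ∀ i : Fin 2, 0 ≤ D.chart x₂ i ∧ D.chart x₂ i < D.N := by
      intro i
      fin_cases i
      · show 0 ≤ D.chart x₂ 0 ∧ D.chart x₂ 0 < D.N
        rw [hx₂j 0 (by decide)]; exact hx₁in
      · exact hx₂in
    have h3 : (G.induce {w | D.chart w - D.chart r ∈ box 2 (ℓ + D.N)}).Reachable ⟨r, D.mem_cylFat_self hr ht⟩ ⟨x₂, D.mem_cylFat_self hr hx₂m⟩ :=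
      D.reach_of_inBox hr (by omega) (D.inBox_of_reduced hr hred) _ _
    exact h3.trans (hr₁.trans hr₂).symm
  exact (key u hu).symm.trans (key v hv)

/-- **Frames at every vertex** (for the record, in the carriers' shape): `v = sec v • typ v`, `typ v ∈ reps`, and `smulIso (sec v)` translates the chart by
`φ v − φ (typ v) = φ v`. [folklore] -/
theorem frame_at (D : OrbitQDatum G A) (v : V) :
    ∃ t ∈ D.reps, ∃ α : G ≃g G, α t = v ∧ ∀ w, D.chart (α w) = D.chart w + (D.chart v - D.chart t) :=
  ⟨D.typ v, D.typ_mem v, smulIso D.act (D.sec v), D.sec_smul v, fun w => by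
    rw [smulIso_apply, D.chart_smul, D.chart_typ, sub_zero, add_comm]
    rfl⟩

end OrbitQDatum

/-! ## §3 The datum exists: finitely many orbits, a character killing a stabiliser, rank two, no exponential growth -/

/-- **THE QUASI-STEP ORBIT DATUM EXISTS** for every action by automorphisms with finitely many orbits (transversal `reps`) of a connected locally finite graph WITHOUT
exponential growth and every character killing one stabiliser and of RANK TWO — no step hypothesis: the scale, the edge bound and the tight quasi-steps come from
good coordinates (`exists_goodCoordinates_of_finite_orbits`, p494591), the kernel bound from the relative Milnor kernel lemma. [cite: KozmaNitzan2024, §4 p. 16 (Lemma 8)]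
[cite: MartineauTassion2017, §3.2] [cite: MilnorSolvableGrowth1968, Lemma 1] -/
theorem exists_orbitQDatum [G.LocallyFinite] (hact : IsActionByAut G A) (hc : G.Connected) (reps : Finset V)
    (htrans : ∀ r ∈ reps, ∀ r' ∈ reps, ∀ a : A, a • r = r' → r = r') (hcover : ∀ w : V, ∃ a : A, ∃ r ∈ reps, a • r = w)
    (c : A →* Multiplicative (Site 2)) {t : V} (hstab : ∀ h ∈ MulAction.stabilizer A t, c h = 1)
    (hrank : ∃ a b : A, MaxArea.det2 (Multiplicative.toAdd (c a)) (Multiplicative.toAdd (c b)) ≠ 0) (hG : ¬ HasExponentialGrowth G) :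
    Nonempty (OrbitQDatum G A) := by
  have hstab' : ∀ (v : V), ∀ h ∈ MulAction.stabilizer A v, c h = 1 := map_stabilizer_eq_one_of_one hact hc c hstab
  obtain ⟨u, v, M, hD0, hlip, hstep⟩ := exists_goodCoordinates_of_finite_orbits hact hc reps htrans hcover c hstab hrank
  set c' : A →* Multiplicative (Site 2) := (rebaseHom u v).comp c with hc'_def
  have hc' : ∀ a, Multiplicative.toAdd (c' a) = MaxArea.rebase u v (Multiplicative.toAdd (c a)) := fun a => rfl
  have hstabc' : ∀ (v : V), ∀ h ∈ MulAction.stabilizer A v, c' h = 1 := fun v h hh => by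
    rw [hc'_def, MonoidHom.comp_apply, hstab' v h hh, map_one]
  set N : ℕ := (MaxArea.det2 u v).natAbs with hN_def
  have hNZ : ((N : ℕ) : ℤ) = |MaxArea.det2 u v| := Int.natCast_natAbs _
  -- the kernel displacement bound at each base (the kernel of `c'` is the kernel of `c`)
  have hker : ∀ r ∈ reps, ∃ m : ℕ, c'.ker = Subgroup.closure {g | g ∈ c'.ker ∧ g • r ∈ graphBall G r m} := fun r hr =>
    AutMilnor.ker_eq_closure_bounded hact hc r (subexp_of_finite_orbits hact hc hcover hG r) _
      (closure_osec_eq_top hact hc hcover htrans hr) c' (hstabc' r)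
  choose! mb hmb using hker
  refine ⟨{ act := hact, conn := hc, reps := reps, cover := hcover, trans := htrans
            ψ := fun a => Multiplicative.toAdd (c' a)
            ψ_mul := fun a b => by simp only [map_mul, toAdd_mul]
            ψ_stab := fun v h hh => by simp only [hstabc' v h hh, toAdd_one]
            N := N, one_le_N := Int.natAbs_pos.2 hD0
            lipN := fun r hr r' hr' a ha i => by rw [hc', hNZ]; exact hlip r hr r' hr' a ha i
            M := M
            qstep := ?_
            m := reps.sup mb
            ker_gen := ?_ }⟩
  · intro r hr i σ
    obtain ⟨a, r', p, hr', hlen, hval, hsupp⟩ := hstep r hr i σ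
    refine ⟨a, r', p, hr', hlen, by rw [hc', hval, hNZ], fun x hx b r'' hr'' hbx j => ?_⟩
    rw [hc', hNZ, ← ochart_smul_of_mem hcover htrans c hstab' b hr'', hbx]
    exact hsupp x hx j
  · intro r hr k hk
    have hk1 : k ∈ c'.ker := by
      rw [MonoidHom.mem_ker, ← ofAdd_toAdd (c' k), show Multiplicative.toAdd (c' k) = 0 from hk, ofAdd_zero]
    have hsub : {g | g ∈ c'.ker ∧ g • r ∈ graphBall G r (mb r)} ⊆ {g : A | Multiplicative.toAdd (c' g) = 0 ∧ g • r ∈ graphBall G r (reps.sup mb)} := by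
      rintro g ⟨hg, hgm⟩
      refine ⟨?_, graphBall_mono _ _ (Finset.le_sup (f := mb) hr) hgm⟩
      rw [MonoidHom.mem_ker] at hg
      rw [hg, toAdd_one]
    exact Subgroup.closure_mono hsub ((hmb r hr).le hk1)

end AutChart

end Summit.CriticalPhenomena.PercolationContinuityZ3.Theorems.Transplant

end
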